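/-
Copyright (c) 2026 the pub-hodgecm-mathlib formalisation cell (harness21).  Prover seat hodgecm-mathlib-F0P3a-p01 (g19): line LH1 «ZENTRUM»
(chair LH1-plan (g4)), organ (B4) O-SPLIT, sub-brick SB2 «central character of the split member»; 2026-09-02.
-/
import Literature.NumberTheory.Rogawski1990.CMLocalAPacketMembers     -- ★ `splitMemberGL`; brings ★ `parabolicIndGL`, `maxParabolicLeviChar`, `rootDeltaChar`
import HarnessLib

/-!
# The central character of `i_{P_{(N-1,1)}}((ν₀ ∘ det) ⊠ χ′)` and of the split A-packet member `i_G(ξ_w)` on the scalars `u·1`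

Topic `NumberTheory/Automorphic`; namespace `Literature.NumberTheory.Automorphic`.  THEOREMS ONLY (no `def`, no instance, no notation,
no named fact, no `sorry`); kernel lane `--supports stmt-HodgeConjecture-24833`; cell `pub/hodgecm-mathlib`, crux H413, line LH1 «ZENTRUM»
CENTRAL-ι sub-leaf, organ (B4) O-SPLIT (census F0P3a-p01 (g19) 2026-09-02T06:55Z, sub-brick SB2).

For a non-archimedean local field `F`, the normalised parabolic induction `i_c σ = Ind_{P_c}^{GL_n}(σ ∘ leviProjection ⊗ δ_{P_c}^{1∕2})`
(★ `Representation.parabolicIndGL`) acts on a CENTRAL element `z ∈ P_c` by the scalar `δ_{P_c}^{1∕2}(z) · c_z` as soon as `σ` acts by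
`c_z` on the Levi projection of `z` (§1 `parabolicIndGL_apply_eq_smul_of_mem_center` — the tree's ★ `parabolicIndGL_apply_of_mem_center`,
which is stated for block labels in `Fin r`, re-run for an arbitrary linearly ordered label type so that it applies to ★
`Zelevinsky1980.lastBlockLabel N : Fin N → Bool`); `δ_{P}^{1∕2} = 1` on central elements (§1 `rootDeltaChar_eq_one_of_mem_center'`, the
modular function being trivial on the centre).  For the Levi character `(ν₀ ∘ det_{GL_{N-1}}) ⊠ χ′` of `P_{(N-1,1)}`
(★ `Zelevinsky1980.maxParabolicLeviChar`) the scalar `u·1_N` projects to the scalar blocks `u·1_{N-1} ⊕ u·1_1`, so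
**`i_{P_{(N-1,1)}}((ν₀ ∘ det) ⊠ χ′)(u·1) = ν₀(u)^{N-1} χ′(u)`** (§2 `parabolicIndGL_maxParabolicLeviChar_apply_of_coe_eq_smul_one`), and
for `N = 3` the split A-packet member `i_G(ξ_w)` (★ `Rogawski1990.splitMemberGL`) has central character `u ↦ ν₀(u)² χ′(u)`
(§3 `splitMemberGL_apply_of_coe_eq_smul_one`) — «the central character of `i_G(χ)` is `χ|_Z`» [Rogawski1990, §12.2 p. 173] read on
`GL₃(E_w)` at a split place [§4.13 p. 62, Lemma 4.13.1 (b)].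
HONEST LABEL: HC_CM is proved only modulo the 2 remaining named inputs (hLiu418 24832, h413 24833) until rung 0 closes; count-neutral.

## References
* [Rogawski1990] J. Rogawski, *Automorphic Representations of Unitary Groups in Three Variables*, Ann. of Math. Stud. 123 (1990), §12.2 p. 173;
  §4.13 p. 62 and Lemma 4.13.1 (b).
* [BernsteinZelevinsky1977] I. N. Bernstein, A. V. Zelevinsky, Ann. Sci. ÉNS 10 (1977), 1.7 and §2.3.
* [BushnellHenniart2006] C. Bushnell, G. Henniart, *The local Langlands conjecture for GL(2)* (2006), §2.4, §2.6.
* [Mok2014] C. P. Mok, *Endoscopic classification of representations of quasi-split unitary groups*, Mem. AMS 235 (2015), §1 Notation p. 5.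
-/

set_option autoImplicit false

noncomputable section

open MeasureTheory
open scoped Matrix MatrixGroups NNReal

namespace Literature.NumberTheory.Automorphic


/-! ## §1 Central elements act on `i_c σ` by `δ^{1∕2}(z)·c_z`; `δ^{1∕2} = 1` on the centre -/

section Center

variable {F : Type*} [Field F] {n : Type*} [Fintype n] [DecidableEq n] {α : Type*} [LinearOrder α] (c : n → α)

/-- A scalar matrix `z` (`z = u • 1`) is central in `GL_n(F)` («we identify the centre of `U(N)` ∕ `GL_N` with the scalars»). [cite: Mok2014, §1 Notation p. 5] -/
theorem mem_center_of_coe_eq_smul_one {z : GL n F} {u : F} (hz : (z : Matrix n n F) = u • (1 : Matrix n n F)) :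
    z ∈ Subgroup.center (GL n F) := by
  rw [Subgroup.mem_center_iff]
  intro g
  refine Units.ext ?_
  rw [Units.val_mul, Units.val_mul, hz, Matrix.mul_smul, Matrix.smul_mul, Matrix.mul_one, Matrix.one_mul]

/-- A scalar matrix lies in every standard parabolic `P_c` (it is diagonal, hence block triangular). [cite: BernsteinZelevinsky1977, §2.1] -/
theorem mem_standardParabolicGL_of_coe_eq_smul_one {z : GL n F} {u : F} (hz : (z : Matrix n n F) = u • (1 : Matrix n n F)) :
    z ∈ standardParabolicGL F c := by
  rw [mem_standardParabolicGL_iff, hz, Matrix.smul_one_eq_diagonal]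
  exact Matrix.blockTriangular_diagonal _

/-- The Levi projection of a scalar matrix `u • 1` has the scalar blocks `u • 1` (the diagonal blocks of a block triangular matrix). [cite: BernsteinZelevinsky1977, §2.1] -/
theorem coe_leviProjection_of_coe_eq_smul_one {z : GL n F} {u : F} (hz : (z : Matrix n n F) = u • (1 : Matrix n n F))
    (hzP : z ∈ standardParabolicGL F c) (a : α) :
    ((leviProjection F c ⟨z, hzP⟩ a : GL {i // c i = a} F) : Matrix {i // c i = a} {i // c i = a} F) =
      u • (1 : Matrix {i // c i = a} {i // c i = a} F) := by
  rw [coe_leviProjection_apply]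
  ext i j
  change (z : Matrix n n F) i j = _
  rw [hz, Matrix.smul_apply, Matrix.smul_apply, Matrix.one_apply, Matrix.one_apply]
  simp only [Subtype.ext_iff]

/-- Hence the determinant of the `a`-block of the Levi projection of `u • 1` is `u ^ #(block a)`. [cite: BernsteinZelevinsky1977, §2.1] -/
theorem det_leviProjection_of_coe_eq_smul_one {z : GL n F} {u : F} (hz : (z : Matrix n n F) = u • (1 : Matrix n n F))
    (hzP : z ∈ standardParabolicGL F c) (a : α) :
    ((Matrix.GeneralLinearGroup.det (leviProjection F c ⟨z, hzP⟩ a) : Fˣ) : F) = u ^ Fintype.card {i // c i = a} := by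
  rw [Matrix.GeneralLinearGroup.val_det_apply, coe_leviProjection_of_coe_eq_smul_one c hz hzP a, Matrix.det_smul, Matrix.det_one, mul_one]

/-- **`δ_P^{1∕2}(z) = 1` for `z` central in the (locally compact) subgroup `P`**: right translation by `z` is left translation, a left Haar
measure is left invariant, so Mathlib's `modularCharacter z = 1` (`modularCharacterFun_eq_haarScalarFactor`, `map_mul_left_eq_self`,
`haarScalarFactor_self`), hence `√Δ_P(z) = 1` (★ `rootDeltaChar_eq_one_of_deltaChar_eq_one`).  (Private twin of the crux-side ★
`F0P3cStCharTSPrincipalSeriesCentral.rootDeltaChar_eq_one_of_mem_center`, which a Literature module may not import.) [cite: BernsteinZelevinsky1977, 1.7] -/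
private theorem rootDeltaChar_eq_one_of_mem_center' {G : Type*} [Group G] [TopologicalSpace G] [IsTopologicalGroup G] (P : Subgroup G)
    [LocallyCompactSpace P] {p : P} (hp : p ∈ Subgroup.center ↥P) : rootDeltaChar P p = 1 := by
  apply rootDeltaChar_eq_one_of_deltaChar_eq_one
  have hmod : Measure.modularCharacter p = 1 := by
    borelize ↥P
    change Measure.modularCharacterFun p = 1
    rw [Measure.modularCharacterFun_eq_haarScalarFactor Measure.haar p]
    have h : (fun x : ↥P => x * p) = fun x => p * x := funext fun x => Subgroup.mem_center_iff.1 hp x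
    have hmap : Measure.map (fun x : ↥P => x * p) Measure.haar = (Measure.haar : Measure ↥P) := by
      rw [h]; exact map_mul_left_eq_self _ p
    convert Measure.haarScalarFactor_self (Measure.haar : Measure ↥P) using 2
  ext
  rw [deltaChar_apply, hmod, Units.val_one, NNReal.coe_one, Complex.ofReal_one]

end Center

section Induction

variable {F : Type*} [Field F] [ValuativeRel F] [TopologicalSpace F] [IsNonarchimedeanLocalField F]
  {n : Type*} [Fintype n] [DecidableEq n] {α : Type*} [LinearOrder α] [Fintype α] (c : n → α)
  {W : Type*} [AddCommGroup W] [Module ℂ W] (σ : Representation ℂ (Π a, GL {i // c i = a} F) W)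

omit [Fintype α] in
/-- **A central element of `P_c` acts on `i_c σ` by a scalar** as soon as `σ` acts by the scalar `c_z` on its Levi projection:
`i_c σ (z) = δ_{P_c}^{1∕2}(z) · c_z · id` (right translation by a central `z` is left translation, and `f(z x) = τ(z) f(x)`) — the tree's
★ `parabolicIndGL_apply_of_mem_center` for an arbitrary (linearly ordered, finite) block-label type. [cite: BushnellHenniart2006, §2.4; §2.6] -/
theorem parabolicIndGL_apply_eq_smul_of_mem_center [LocallyCompactSpace (standardParabolicGL F c)] {z : GL n F}
    (hz : z ∈ Subgroup.center (GL n F)) (hzP : z ∈ standardParabolicGL F c) {cz : ℂ}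
    (hσz : ∀ w, σ (leviProjection F c ⟨z, hzP⟩) w = cz • w)
    (f : Representation.SmoothInd (standardParabolicGL F c)
      (Representation.twist (σ.comp (leviProjection F c)) (rootDeltaChar (standardParabolicGL F c)))) :
    Representation.parabolicIndGL F c σ z f = ((((rootDeltaChar (standardParabolicGL F c) ⟨z, hzP⟩ : ℂˣ) : ℂ) * cz) • f) := by
  refine Representation.SmoothInd.ext (funext fun x => ?_)
  change (Representation.smoothIndRep _ _ z f).toFun x = _
  rw [Representation.toFun_smoothIndRep_apply, Representation.SmoothInd.toFun_smul, Pi.smul_apply, Subgroup.mem_center_iff.1 hz x]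
  have h := f.toFun_subgroup_mul ⟨z, hzP⟩ x
  rw [Subgroup.coe_mk] at h
  rw [h, Representation.twist_apply, MonoidHom.comp_apply, hσz, smul_smul]

omit [ValuativeRel F] [TopologicalSpace F] [IsNonarchimedeanLocalField F] [Fintype α] in
/-- A central element of `GL_n(F)` lying in `P_c` is central in `P_c`. [folklore] -/
private theorem mem_center_standardParabolicGL_of_mem_center {z : GL n F} (hz : z ∈ Subgroup.center (GL n F))
    (hzP : z ∈ standardParabolicGL F c) : (⟨z, hzP⟩ : standardParabolicGL F c) ∈ Subgroup.center ↥(standardParabolicGL F c) := by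
  rw [Subgroup.mem_center_iff]
  intro g
  exact Subtype.ext (Subgroup.mem_center_iff.1 hz g)

omit [Fintype α] in
/-- **Central scalars act on `i_c σ` by `c_z` alone** (`δ_{P_c}^{1∕2}(z) = 1` for `z` central): for `z = u • 1` with `σ` acting by `c_z` on
its Levi projection, `i_c σ (z) f = c_z • f`. [cite: BushnellHenniart2006, §2.4; §2.6] [cite: BernsteinZelevinsky1977, 1.7] -/
theorem parabolicIndGL_apply_eq_smul_of_coe_eq_smul_one [LocallyCompactSpace (standardParabolicGL F c)] {z : GL n F} {u : F}
    (hz : (z : Matrix n n F) = u • (1 : Matrix n n F)) {cz : ℂ}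
    (hσz : ∀ w, σ (leviProjection F c ⟨z, mem_standardParabolicGL_of_coe_eq_smul_one c hz⟩) w = cz • w)
    (f : Representation.SmoothInd (standardParabolicGL F c)
      (Representation.twist (σ.comp (leviProjection F c)) (rootDeltaChar (standardParabolicGL F c)))) :
    Representation.parabolicIndGL F c σ z f = cz • f := by
  rw [parabolicIndGL_apply_eq_smul_of_mem_center c σ (mem_center_of_coe_eq_smul_one hz) (mem_standardParabolicGL_of_coe_eq_smul_one c hz) hσz,
    rootDeltaChar_eq_one_of_mem_center' (standardParabolicGL F c)
      (mem_center_standardParabolicGL_of_mem_center c (mem_center_of_coe_eq_smul_one hz) _),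
    Units.val_one, one_mul]

end Induction

/-! ## §2 The Levi character `(ν₀ ∘ det) ⊠ χ′` of `P_{(N-1,1)}` on the scalars -/

section LeviChar

variable {F : Type} [Field F] [ValuativeRel F] [TopologicalSpace F] [IsNonarchimedeanLocalField F] (N : ℕ)
  (ν₀ χ' : Fˣ →* ℂˣ)

omit [ValuativeRel F] [TopologicalSpace F] [IsNonarchimedeanLocalField F] in
/-- The Levi character `(ν₀ ∘ det) ⊠ χ′` evaluated at a Levi element whose two blocks are the scalars `u • 1`:
`ν₀(u ^ #block₀) · χ′(u ^ #block₁)` (as complex numbers). [cite: Rogawski1990, Lemma 4.13.1 (b) p. 62] -/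
theorem maxParabolicLeviChar_apply_of_coe_eq_smul_one (m : Π a : Bool, GL {i : Fin N // Zelevinsky1980.lastBlockLabel N i = a} F) (u : Fˣ)
    (hm : ∀ a, ((m a).val : Matrix {i : Fin N // Zelevinsky1980.lastBlockLabel N i = a} {i : Fin N // Zelevinsky1980.lastBlockLabel N i = a} F) =
      (u : F) • (1 : Matrix {i : Fin N // Zelevinsky1980.lastBlockLabel N i = a} {i : Fin N // Zelevinsky1980.lastBlockLabel N i = a} F)) :
    Zelevinsky1980.maxParabolicLeviChar F N ν₀ χ' m =
      ν₀ (u ^ Fintype.card {i : Fin N // Zelevinsky1980.lastBlockLabel N i = false}) *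
        χ' (u ^ Fintype.card {i : Fin N // Zelevinsky1980.lastBlockLabel N i = true}) := by
  have hdet : ∀ a, Matrix.GeneralLinearGroup.det (m a) = u ^ Fintype.card {i : Fin N // Zelevinsky1980.lastBlockLabel N i = a} := by
    intro a
    refine Units.ext ?_
    rw [Matrix.GeneralLinearGroup.val_det_apply, hm a, Matrix.det_smul, Matrix.det_one, mul_one, Units.val_pow_eq_pow_val]
  rw [Zelevinsky1980.maxParabolicLeviChar_apply, hdet, hdet]

/-- **`i_{P_{(N-1,1)}}((ν₀ ∘ det) ⊠ χ′)` acts on the scalar `u • 1_N` by `ν₀(u)^{#block₀} · χ′(u)^{#block₁}`** (`= ν₀(u)^{N-1} χ′(u)`):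
the central character of the degenerate principal series of the maximal parabolic. [cite: Rogawski1990, §12.2 p. 173; Lemma 4.13.1 (b) p. 62] -/
theorem parabolicIndGL_maxParabolicLeviChar_apply_of_coe_eq_smul_one
    [LocallyCompactSpace (standardParabolicGL F (Zelevinsky1980.lastBlockLabel N))] {z : GL (Fin N) F} (u : Fˣ)
    (hz : (z : Matrix (Fin N) (Fin N) F) = (u : F) • (1 : Matrix (Fin N) (Fin N) F))
    (f : Representation.SmoothInd (standardParabolicGL F (Zelevinsky1980.lastBlockLabel N))
      (Representation.twist
        (((Representation.trivial ℂ (Π a : Bool, GL {i : Fin N // Zelevinsky1980.lastBlockLabel N i = a} F) ℂ).twist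
            (Zelevinsky1980.maxParabolicLeviChar F N ν₀ χ')).comp (leviProjection F (Zelevinsky1980.lastBlockLabel N)))
        (rootDeltaChar (standardParabolicGL F (Zelevinsky1980.lastBlockLabel N))))) :
    Representation.parabolicIndGL F (Zelevinsky1980.lastBlockLabel N)
        ((Representation.trivial ℂ (Π a : Bool, GL {i : Fin N // Zelevinsky1980.lastBlockLabel N i = a} F) ℂ).twist
          (Zelevinsky1980.maxParabolicLeviChar F N ν₀ χ')) z f =
      (((ν₀ u : ℂˣ) : ℂ) ^ Fintype.card {i : Fin N // Zelevinsky1980.lastBlockLabel N i = false} *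
        ((χ' u : ℂˣ) : ℂ) ^ Fintype.card {i : Fin N // Zelevinsky1980.lastBlockLabel N i = true}) • f := by
  refine parabolicIndGL_apply_eq_smul_of_coe_eq_smul_one (Zelevinsky1980.lastBlockLabel N) _ hz (fun w => ?_) f
  rw [Representation.twist_apply, Representation.trivial_apply,
    maxParabolicLeviChar_apply_of_coe_eq_smul_one N ν₀ χ' _ u
      (fun a => coe_leviProjection_of_coe_eq_smul_one (Zelevinsky1980.lastBlockLabel N) hz _ a),
    Units.val_mul, map_pow, map_pow, Units.val_pow_eq_pow_val, Units.val_pow_eq_pow_val]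

end LeviChar

/-! ## §3 `N = 3`: the split A-packet member `i_G(ξ_w)` has central character `u ↦ ν₀(u)² χ′(u)` -/

section Split

variable {F : Type} [Field F] [ValuativeRel F] [TopologicalSpace F] [IsNonarchimedeanLocalField F]
  [LocallyCompactSpace (standardParabolicGL F (Zelevinsky1980.lastBlockLabel 3))]
  (ν₀ χ' : Fˣ →* ℂˣ) (hν₀u : ∀ x, ‖((ν₀ x : ℂˣ) : ℂ)‖ = 1) (hν₀c : Continuous fun x => ((ν₀ x : ℂˣ) : ℂ))
  (hχ'u : ∀ x, ‖((χ' x : ℂˣ) : ℂ)‖ = 1) (hχ'c : Continuous fun x => ((χ' x : ℂˣ) : ℂ))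

/-- The two blocks of `P_{(2,1)} ≤ GL₃` have sizes `2` and `1`. [cite: Rogawski1990, §4.13 p. 62] -/
theorem card_lastBlockLabel_three_false : Fintype.card {i : Fin 3 // Zelevinsky1980.lastBlockLabel 3 i = false} = 2 := by
  decide

/-- The last block of `P_{(2,1)} ≤ GL₃` has size `1`. [cite: Rogawski1990, §4.13 p. 62] -/
theorem card_lastBlockLabel_three_true : Fintype.card {i : Fin 3 // Zelevinsky1980.lastBlockLabel 3 i = true} = 1 := by
  decide

/-- **THE CENTRAL CHARACTER OF THE SPLIT MEMBER `i_G(ξ_w) = (ν₀ ∘ det_{GL₂}) × χ′`** (★ `Rogawski1990.splitMemberGL`): for every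
`z ∈ GL₃(F)` with matrix `u • 1`, `i_G(ξ_w)(z) f = ν₀(u)² χ′(u) • f`.  With `ν₀ = η_w ψ_w μ_w`, `χ′ = ψ_w` (★ `OneDimAutRepH.splitν₀`,
`locψ`) this is `η_w(u)² ψ_w(u)³ μ_w(u)²`. [cite: Rogawski1990, §12.2 p. 173; Lemma 4.13.1 (b) p. 62; §13.3 p. 201] -/
theorem splitMemberGL_apply_of_coe_eq_smul_one {z : GL (Fin 3) F} (u : Fˣ)
    (hz : (z : Matrix (Fin 3) (Fin 3) F) = (u : F) • (1 : Matrix (Fin 3) (Fin 3) F))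
    (f : (Rogawski1990.splitMemberGL F ν₀ χ' hν₀u hν₀c hχ'u hχ'c).V) :
    (Rogawski1990.splitMemberGL F ν₀ χ' hν₀u hν₀c hχ'u hχ'c).ρ z f = (((ν₀ u : ℂˣ) : ℂ) ^ 2 * ((χ' u : ℂˣ) : ℂ)) • f := by
  have h := parabolicIndGL_maxParabolicLeviChar_apply_of_coe_eq_smul_one 3 ν₀ χ' u hz f
  rw [card_lastBlockLabel_three_false, card_lastBlockLabel_three_true, pow_one] at h
  exact h

end Split

end Literature.NumberTheory.Automorphic

end
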